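import Summits.QuantumFields.BalabanUV.T4Continuum.Support.NE7SliceGreenDecayRows
import HarnessLib

/-!
# NE7SliceGreenTorusLocalised — THE SLICE SOLVER LETTER G♭ LOCALISED (torus side): if the curl pairing of a `ker Q_k` field `x` against `ker Q_k` is bounded by a
# GLOBAL density `g_a` PLUS an extra density `g_b` carried by test fields on a FAR bond set `S_f` (all of whose blocks are at torus block-distance `≥ ℓ₀` from a
# block `y₀`), then every plaquette value of `x` IN THE BLOCK `y₀` is `≤ K_a·g_a + K_b·e^{−c·ℓ₀}·g_b` — G1 `NE7SliceGreenTorus` re-run with the exponentially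
# DECAYING rows of the tree in place of the global sup rows: GAN24's `Entry110Rect.entry110Grad_one` ([Balaban1984PropagatorsI] (1.110) entry 2 for `∇Δ_1⁻¹`,
# every torus) and lit-balaban's `H_k` kernel decay (`B5Hk163Torus.norm_HkOp_le`); `K_a, K_b, c` depend on the dimension ONLY

Cell `pub-balaban`, rung (B)+1 sub-cell t4, lineage `b2b-balaban-t4-ne7-p1` (CRUX PROVER NE7 #1 = OWNER of row NE7), generation 89; memo
`t4/b2b-balaban-t4-ne7-p1-g89/COSTING-N1.md` §3.  File F253b (over F253a `NE7SliceGreenDecayRows` and G1 `NE7SliceGreenTorus` §1–§4 BY NAME: `sum_norm_QvOp_mulVec_le`, `sum_norm_HkOp_QvOp_mulVec_le`,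
`curlAdjCurl_mulVec_apply`, `Fs_eq_fdiff_DeltaA_inv`; GAN24 `Entry110Rect.entry110Grad_one`; lit-balaban `B5Hk163Torus.norm_HkOp_le`,
`B5Hk163TorusHolderRate.sum_exp_torusSupNorm_sub_rep_le`, `B5Hk163RDiv.curl_HkOp_orthogonal`; the β sub-cell's digit lemmas `Beta.FluctuationProjection.bpt_add_tstep_of_lt ∕
_of_le ∕ bpt_blockOf_digitOf`; torus-distance bookkeeping `SmallCouplingEntryDecay.torusSupNorm_rep_triangle`, `AveragingKernelRows.torusSupNorm_rep_sub_comm`).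

WHY (torus road v2, F252 `NE7ApeFlatSkeletonLocalised`).  F252's bootstrap consumes a LOCALISED solver letter: sources bounded by `a‖Y‖_{1,near} + b‖Y‖_{1,far}` give
`‖d_1X(p)‖ ≤ K_G(a + ϵ·b)` at the plaquette `p`, `ϵ ≍ e^{−c·dist}`.  G1 proved the GLOBAL letter (`ϵ = 1`) from the global sup entry of [B5] (1.115); the tree ALSO holds the
decaying entry (1.110) (GAN24, every torus, uniformly in the spacing) and `H_k`'s kernel decay, so the localised letter is a composition: (§3) the far column sums of `H_k`
decay like `e^{−m(ℓ₀ − s)}` at coarse bonds within block-distance `s` of `y₀`; (§4) hence the source `J = ½∂ᴴ∂x` at a bond of block-distance `s` from `y₀` is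
`≤ ½[g_a(1 + C_HQ) + g_b(1 + C_T)e^{m(s − ℓ₀)}]` (test field `e_i − H_kQ_ke_i` as in G1 §3, its far `ℓ¹` mass by §3 and the support of `Q_ke_i` — §2, the digit
lemmas); (§5) the decaying row of `∇Δ_1⁻¹`, block by block, turns this into `|F(x)(t)| ≤ K_a g_a + K_b e^{−mℓ₀} g_b` for `t` in the block `y₀` (the growth `e^{ms}` is
beaten by the row's `e^{−δ₀s}` since `m ≤ δ₀∕2`).  This is print's mechanism of [Balaban1985Variational] Sect. F (161)∕(163) («(2.47)–(2.51) of [3]»: far data are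
discounted exponentially by the kernels), in the tree's dictionary at `U = 1`.
WHAT ([folklore] composition; 0 def, 0 sorry; dimension `d + 1`).  (§3 = F253a `sum_far_norm_HkOp_col_le`, §2 = F253a `tsn_le_one_of_QvOp_single_ne_zero`, §5 = F253a
`norm_fdiff_inv_mulVec_le_blockwise`.)
§1 **`norm_curlAdjCurl_mulVec_le_localised`** — the localised source bound; §2 **`exists_sliceGreen_localised_const`** — the END (statement in its docstring).
HONEST FRAMING (page 1): a composition of tree theorems at `U = 1`; constants existential, functions of `d` only (GAN24's `(δ₀, C)`, lit-balaban's decay constants); nothing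
printed is asserted ([B5] (1.110) p. 35 and [B11] (161)∕(163) p. 303 are TEXT LOCATIONS); the T4-side transfer (test directions, entries, F252's `hGloc` binder) is the
successor file; NOT (APE), NOT ONE-STEP, NOT NE7; spine 0∕9; finite T⁴ rung (B)+1 — NOT infinite volume, NOT mass gap, NOT `BetaPertH`, NOT Clay.  Continuum YM on T⁴ ⇐
BetaPertH ∧ nine spine estimates (0/9 proved); BetaPertH ⇐ (D1) ∧ (D4) ∧ CAP+tail; G-an2-4 gates asym, D1 and NE2/3/4.
-/

set_option autoImplicit false

open scoped BigOperators Matrix ComplexConjugate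
open Finset

namespace Summit.QuantumFields.BalabanUV.T4Continuum.NE7SliceGreenTorusLocalised

open Literature.MathematicalPhysics.QuantumFieldTheory.Balaban1983to89
open B5Prop11Plancherel (Tor fine fdiff unitVec)
open B5Action121 (Fs CurlOp)
open B5Block118 (QvOp bpt tstep)
open B5Blocks16 (blockOf blockOf_bpt bpt_bijective)
open B5DeltaA169 (DeltaA)
open B5Hk163Torus (HkOp QvOp_HkOp_mulVec norm_HkOp_le)
open B5Hk163RDiv (curl_HkOp_orthogonal)
open B5Hk163Strip (kappa163 kappa163_pos)
open B5Hk163Decay (MG163 MG163_nonneg)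
open B4TorusKernel (periodConst)
open B4TorusKernel.MultiPeriod (torusSupNorm torusSupNorm_nonneg torusSupNorm_translate translate circAbs circAbs_le_abs)
open B4Sect5Proof (latticeConst latticeConst_nonneg)
open B5Kernel166Decay (periodConst_pos)
open B5Hk163TorusHolderRate (sum_exp_torusSupNorm_sub_rep_le)
open B6LowerBound2153Torus (toT rep toT_rep toT_add toT_unitVec isPeriod_rep_toT_sub)
open B6Cov2156Torus (one_le_M)
open SmallCouplingEntryDecay (torusSupNorm_rep_triangle)
open AveragingKernelRows (torusSupNorm_rep_sub_comm)
open T4EtaRateOperatorTorus (torusSupNorm_neg torusSupNorm_zero)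
open Beta.FluctuationProjection (digitOf bpt_blockOf_digitOf bpt_add_tstep_of_lt bpt_add_tstep_of_le)
open B5Prop12Entries110 (Entry110Grad)
open Beta.GAN24.Entry110Rect (entry110Grad_one)
open NE7SliceGreenTorus (sum_norm_QvOp_mulVec_le sum_norm_HkOp_QvOp_mulVec_le curlAdjCurl_mulVec_apply Fs_eq_fdiff_DeltaA_inv)
open NE7SliceGreenDecayRows (tsn_le_one_of_QvOp_single_ne_zero sum_far_norm_HkOp_col_le norm_fdiff_inv_mulVec_le_blockwise)

noncomputable section

variable {d : ℕ}

/-! ## §1 The localised source bound -/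

section Source

variable (n : ℕ) [NeZero n] (M : Fin (d + 1) → ℕ) [∀ μ, NeZero (M μ)]

/-- **THE SOURCE BOUND, LOCALISED**: if `Q_kx = 0` and `|⟨∂a, ∂x⟩| ≤ g_a‖a‖₁ + g_b‖a|_{S_f}‖₁` on `ker Q_k`, with every block of `S_f` at block distance `≥ ℓ₀` from `y₀`,
then at a bond `i` whose block is at block distance `≤ s` from `y₀`:
`|(∂ᴴ∂x)(i)| ≤ g_a(1 + C_HQ) + g_b(e^{m(s−ℓ₀)} + (d+1)·M_G·c_P·K_{d+1}(κ′−m)·e^{m(s+1−ℓ₀)})` — G1 §3's test field `e_i − H_kQ_ke_i` (curl-orthogonality), its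
global `ℓ¹` mass `1 + C_HQ` (G1 §2), and its FAR mass: `1_{i ∈ S_f} ≤ e^{m(s − ℓ₀)}`, `‖(H_kQ_ke_i)|_{S_f}‖₁ ≤ ‖Q_ke_i‖₁ · max_b Σ_{j∈S_f}|H_k(j,b)|` over the
support of `Q_ke_i` (§2: blocks within distance `1` of the block of `i`; §3; `‖Q_ke_i‖₁ ≤ n^{−(d+1)}` by G1 §1). [folklore] -/
theorem norm_curlAdjCurl_mulVec_le_localised (x : Tor (fine n M) × Fin (d + 1) → ℂ) (hx : QvOp n M *ᵥ x = 0)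
    (y₀ : Tor M) (ℓ₀ : ℝ) (Sf : Finset (Tor (fine n M) × Fin (d + 1)))
    (hSf : ∀ j ∈ Sf, ℓ₀ ≤ torusSupNorm M (rep M (blockOf n M j.1) - rep M y₀))
    {ga gb : ℝ} (hga : 0 ≤ ga) (hgb : 0 ≤ gb)
    (hg : ∀ a : Tor (fine n M) × Fin (d + 1) → ℂ, QvOp n M *ᵥ a = 0 →
      ‖star (CurlOp (fine n M) (n : ℂ) *ᵥ a) ⬝ᵥ (CurlOp (fine n M) (n : ℂ) *ᵥ x)‖ ≤ ga * ∑ j, ‖a j‖ + gb * ∑ j ∈ Sf, ‖a j‖)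
    {m : ℝ} (hm0 : 0 < m) (hmκ : m < kappa163 (d + 1) / (d + 1))
    (i : Tor (fine n M) × Fin (d + 1)) (s : ℝ) (his : torusSupNorm M (rep M (blockOf n M i.1) - rep M y₀) ≤ s) :
    ‖(((CurlOp (fine n M) (n : ℂ))ᴴ * CurlOp (fine n M) (n : ℂ)) *ᵥ x) i‖
      ≤ ga * (1 + ((d + 1 : ℕ) : ℝ) * (MG163 (d + 1) * periodConst (kappa163 (d + 1)) d * latticeConst (d + 1) (kappa163 (d + 1) / (d + 1))))
        + gb * (Real.exp (m * (s - ℓ₀))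
            + ((d + 1 : ℕ) : ℝ) * (MG163 (d + 1) * periodConst (kappa163 (d + 1)) d * latticeConst (d + 1) (kappa163 (d + 1) / (d + 1) - m))
              * Real.exp (m * (s + 1 - ℓ₀))) := by
  classical
  have hn : (0 : ℝ) < n := by exact_mod_cast Nat.pos_of_ne_zero (NeZero.ne n)
  set C := CurlOp (fine n M) (n : ℂ) with hC
  set e : Tor (fine n M) × Fin (d + 1) → ℂ := Pi.single i 1 with he
  set q : Tor M × Fin (d + 1) → ℂ := QvOp n M *ᵥ e with hq
  set h : Tor (fine n M) × Fin (d + 1) → ℂ := HkOp n M *ᵥ q with hh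
  set CHQ := ((d + 1 : ℕ) : ℝ) * (MG163 (d + 1) * periodConst (kappa163 (d + 1)) d * latticeConst (d + 1) (kappa163 (d + 1) / (d + 1))) with hCHQ
  set CF := ((d + 1 : ℕ) : ℝ) * (n : ℝ) ^ (d + 1)
          * (MG163 (d + 1) * periodConst (kappa163 (d + 1)) d * latticeConst (d + 1) (kappa163 (d + 1) / (d + 1) - m))
          * Real.exp (m * (s + 1 - ℓ₀)) with hCF
  -- the test field `a = e − h` lies in `ker Q_k`
  have ha : QvOp n M *ᵥ (e - h) = 0 := by
    rw [Matrix.mulVec_sub, hh, hq, QvOp_HkOp_mulVec, sub_self]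
  -- the lift is curl-orthogonal to `x`
  have horth : star (C *ᵥ h) ⬝ᵥ (C *ᵥ x) = 0 := by
    have h0 := curl_HkOp_orthogonal n M q x hx
    rw [← hC, ← hh] at h0
    rw [Matrix.star_dotProduct, h0, star_zero]
  have hsplit : star (C *ᵥ e) ⬝ᵥ (C *ᵥ x) = star (C *ᵥ (e - h)) ⬝ᵥ (C *ᵥ x) := by
    rw [Matrix.mulVec_sub, star_sub, sub_dotProduct, horth, sub_zero]
  -- global `ℓ¹` mass of the test field (G1 §2)
  have he1 : ∑ j, ‖e j‖ = 1 := by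
    rw [Finset.sum_eq_single i (fun j _ hj => by rw [he, Pi.single_eq_of_ne hj, norm_zero]) (fun hi => absurd (Finset.mem_univ i) hi),
      he, Pi.single_eq_same, norm_one]
  have hl1 : ∑ j, ‖(e - h) j‖ ≤ 1 + CHQ := by
    calc ∑ j, ‖(e - h) j‖ ≤ ∑ j, (‖e j‖ + ‖h j‖) := Finset.sum_le_sum fun j _ => norm_sub_le _ _
      _ = 1 + ∑ j, ‖h j‖ := by rw [Finset.sum_add_distrib, he1]
      _ ≤ _ := by
          have h2 := sum_norm_HkOp_QvOp_mulVec_le n M e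
          rw [he1, mul_one] at h2
          rw [hh, hq]
          linarith
  -- FAR mass of the test field: the delta part
  have hefar : ∑ j ∈ Sf, ‖e j‖ ≤ Real.exp (m * (s - ℓ₀)) := by
    by_cases hi : i ∈ Sf
    · have hℓs : ℓ₀ ≤ s := (hSf i hi).trans his
      calc ∑ j ∈ Sf, ‖e j‖ ≤ ∑ j, ‖e j‖ := Finset.sum_le_univ_sum_of_nonneg fun j => norm_nonneg _
        _ = 1 := he1
        _ ≤ Real.exp (m * (s - ℓ₀)) := Real.one_le_exp (by nlinarith)
    · have h0 : ∑ j ∈ Sf, ‖e j‖ = 0 :=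
        Finset.sum_eq_zero fun j hj => by
          have hji : j ≠ i := fun hji => hi (hji ▸ hj)
          rw [he, Pi.single_eq_of_ne hji, norm_zero]
      rw [h0]; exact (Real.exp_pos _).le
  -- FAR mass of the test field: the lift part
  have hhfar : ∑ j ∈ Sf, ‖h j‖ ≤ (1 / (n : ℝ) ^ (d + 1)) * CF := by
    -- `Σ_{j∈S_f} |h j| ≤ Σ_b |q b| · Σ_{j∈S_f} |H_k(j,b)|`
    have h1 : ∑ j ∈ Sf, ‖h j‖ ≤ ∑ b, ‖q b‖ * ∑ j ∈ Sf, ‖HkOp n M j b‖ := by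
      calc ∑ j ∈ Sf, ‖h j‖ ≤ ∑ j ∈ Sf, ∑ b, ‖HkOp n M j b‖ * ‖q b‖ := by
            refine Finset.sum_le_sum fun j _ => ?_
            rw [hh, Matrix.mulVec, dotProduct]
            exact (norm_sum_le _ _).trans (Finset.sum_le_sum fun b _ => norm_mul_le _ _)
        _ = ∑ b, ‖q b‖ * ∑ j ∈ Sf, ‖HkOp n M j b‖ := by
            rw [Finset.sum_comm]
            refine Finset.sum_congr rfl fun b _ => ?_
            rw [Finset.mul_sum]
            refine Finset.sum_congr rfl fun j _ => mul_comm _ _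
    -- on the support of `q = Q_ke_i` the far column sum is `≤ CF` (§2 + §3 with `s + 1`)
    have h2 : ∀ b, ‖q b‖ * ∑ j ∈ Sf, ‖HkOp n M j b‖ ≤ ‖q b‖ * CF := by
      intro b
      by_cases hqb : q b = 0
      · rw [hqb, norm_zero, zero_mul, zero_mul]
      · refine mul_le_mul_of_nonneg_left ?_ (norm_nonneg _)
        have hb1 : torusSupNorm M (rep M (blockOf n M i.1) - rep M b.1) ≤ 1 := by
          rw [hq, he] at hqb
          exact tsn_le_one_of_QvOp_single_ne_zero n M i b hqb
        have hbs : torusSupNorm M (rep M b.1 - rep M y₀) ≤ s + 1 := by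
          have htri := torusSupNorm_rep_triangle M b.1 (blockOf n M i.1) y₀
          rw [torusSupNorm_rep_sub_comm M b.1 (blockOf n M i.1)] at htri
          linarith
        exact sum_far_norm_HkOp_col_le n M y₀ ℓ₀ (s + 1) Sf hSf b hbs hm0 hmκ
    have h3 : ∑ b, ‖q b‖ ≤ 1 / (n : ℝ) ^ (d + 1) := by
      have := sum_norm_QvOp_mulVec_le n M e
      rw [he1, mul_one] at this
      rw [hq]; exact this
    have hCF0 : 0 ≤ CF := by
      have := MG163_nonneg (d + 1)
      have := (periodConst_pos (kappa163_pos (d + 1)) d).le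
      have := latticeConst_nonneg (d + 1) (show 0 ≤ kappa163 (d + 1) / (d + 1) - m by linarith)
      positivity
    calc ∑ j ∈ Sf, ‖h j‖ ≤ ∑ b, ‖q b‖ * CF := h1.trans (Finset.sum_le_sum fun b _ => h2 b)
      _ = (∑ b, ‖q b‖) * CF := by rw [Finset.sum_mul]
      _ ≤ _ := mul_le_mul_of_nonneg_right h3 hCF0
  have hfar : ∑ j ∈ Sf, ‖(e - h) j‖
      ≤ Real.exp (m * (s - ℓ₀)) + (1 / (n : ℝ) ^ (d + 1)) * CF := by
    calc ∑ j ∈ Sf, ‖(e - h) j‖ ≤ ∑ j ∈ Sf, (‖e j‖ + ‖h j‖) := Finset.sum_le_sum fun j _ => norm_sub_le _ _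
      _ = ∑ j ∈ Sf, ‖e j‖ + ∑ j ∈ Sf, ‖h j‖ := Finset.sum_add_distrib
      _ ≤ _ := add_le_add hefar hhfar
  -- the volume cancels in `n^{−(d+1)}·CF`
  have hvol : (1 / (n : ℝ) ^ (d + 1)) * CF
      = ((d + 1 : ℕ) : ℝ) * (MG163 (d + 1) * periodConst (kappa163 (d + 1)) d * latticeConst (d + 1) (kappa163 (d + 1) / (d + 1) - m))
          * Real.exp (m * (s + 1 - ℓ₀)) := by
    rw [hCF]
    field_simp
  rw [curlAdjCurl_mulVec_apply, ← he, ← hC, hsplit]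
  calc ‖star (C *ᵥ (e - h)) ⬝ᵥ (C *ᵥ x)‖ ≤ ga * ∑ j, ‖(e - h) j‖ + gb * ∑ j ∈ Sf, ‖(e - h) j‖ := hg (e - h) ha
    _ ≤ ga * (1 + CHQ) + gb * (Real.exp (m * (s - ℓ₀)) + (1 / (n : ℝ) ^ (d + 1)) * CF) :=
        add_le_add (mul_le_mul_of_nonneg_left hl1 hga) (mul_le_mul_of_nonneg_left hfar hgb)
    _ = _ := by rw [hvol]

end Source

/-! ## §2 THE END (torus side): the localised slice Green letter -/

/-- **THE SLICE SOLVER LETTER ON THE TORUS, LOCALISED, `k`-UNIFORM** (dimension `d + 1`): there are `K_a, K_b, c > 0` depending on `d` only such that for EVERY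
`n ≥ 1`, EVERY period vector `M`, every fine field `x` with `Q_kx = 0`, every block `y₀`, radius `ℓ₀`, and bond set `S_f` all of whose blocks are at torus
block-distance `≥ ℓ₀` from `y₀`, every `g_a, g_b ≥ 0` with `|⟨∂a, ∂x⟩| ≤ g_a·Σ|a| + g_b·Σ_{S_f}|a|` for all `a ∈ ker Q_k` (curl pairing at lattice factor `n`), and
every plaquette at a site of the block `y₀`: `|F_{μν}(x)(t)| ≤ K_a·g_a + K_b·e^{−c·ℓ₀}·g_b`.  (`S_f = ∅` or `g_b = 0` is G1's global letter.) [folklore] -/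
theorem exists_sliceGreen_localised_const :
    ∃ Ka Kb c : ℝ, 0 < Ka ∧ 0 < Kb ∧ 0 < c ∧ ∀ (n : ℕ) [NeZero n] (M : Fin (d + 1) → ℕ) [∀ μ, NeZero (M μ)]
      (x : Tor (fine n M) × Fin (d + 1) → ℂ), QvOp n M *ᵥ x = 0 →
      ∀ (y₀ : Tor M) (ℓ₀ : ℝ) (Sf : Finset (Tor (fine n M) × Fin (d + 1))),
      (∀ j ∈ Sf, ℓ₀ ≤ torusSupNorm M (rep M (blockOf n M j.1) - rep M y₀)) →
      ∀ ga gb : ℝ, 0 ≤ ga → 0 ≤ gb →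
      (∀ a : Tor (fine n M) × Fin (d + 1) → ℂ, QvOp n M *ᵥ a = 0 →
        ‖star (CurlOp (fine n M) (n : ℂ) *ᵥ a) ⬝ᵥ (CurlOp (fine n M) (n : ℂ) *ᵥ x)‖ ≤ ga * ∑ j, ‖a j‖ + gb * ∑ j ∈ Sf, ‖a j‖) →
      ∀ (μ ν : Fin (d + 1)) (r : Fin (d + 1) → Fin n),
        ‖Fs (fine n M) (n : ℂ) x μ ν (bpt n M y₀ r)‖ ≤ Ka * ga + Kb * Real.exp (-(c * ℓ₀)) * gb := by
  classical
  obtain ⟨δ₀, C, hδ₀, hC, hrow⟩ := (entry110Grad_one (d := d))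
  have hκ' : 0 < kappa163 (d + 1) / (d + 1) := div_pos (kappa163_pos (d + 1)) (by positivity)
  -- the common rate
  set m : ℝ := min (δ₀ / 2) (kappa163 (d + 1) / (d + 1) / 2) with hm
  have hm0 : 0 < m := lt_min (by linarith) (by linarith)
  have hmδ : m ≤ δ₀ / 2 := min_le_left _ _
  have hmκ : m < kappa163 (d + 1) / (d + 1) := (min_le_right _ _).trans_lt (by linarith)
  have hMG := MG163_nonneg (d + 1)
  have hpC := (periodConst_pos (kappa163_pos (d + 1)) d).le
  set CHQ := ((d + 1 : ℕ) : ℝ) * (MG163 (d + 1) * periodConst (kappa163 (d + 1)) d * latticeConst (d + 1) (kappa163 (d + 1) / (d + 1))) with hCHQ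
  set CT := ((d + 1 : ℕ) : ℝ) * (MG163 (d + 1) * periodConst (kappa163 (d + 1)) d * latticeConst (d + 1) (kappa163 (d + 1) / (d + 1) - m))
    * Real.exp m with hCT
  have hCHQ0 : 0 ≤ CHQ := by
    have := latticeConst_nonneg (d + 1) hκ'.le
    positivity
  have hCT0 : 0 ≤ CT := by
    have := latticeConst_nonneg (d + 1) (show 0 ≤ kappa163 (d + 1) / (d + 1) - m by linarith)
    positivity
  have hKa0 : 0 ≤ latticeConst (d + 1) δ₀ := latticeConst_nonneg _ hδ₀.le
  have hKb0 : 0 ≤ latticeConst (d + 1) (δ₀ - m) := latticeConst_nonneg _ (by linarith)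
  refine ⟨C * (1 + CHQ) * latticeConst (d + 1) δ₀ + 1, C * (1 + CT) * latticeConst (d + 1) (δ₀ - m) + 1, m, by positivity, by positivity, hm0,
    fun n _ M _ x hx y₀ ℓ₀ Sf hSf ga gb hga hgb hg μ ν r => ?_⟩
  set J : Tor (fine n M) × Fin (d + 1) → ℂ :=
    (1 / 2 : ℂ) • (((CurlOp (fine n M) (n : ℂ))ᴴ * CurlOp (fine n M) (n : ℂ)) *ᵥ x) with hJ
  -- the blockwise bound of the source (§4 at `s :=` the block distance itself)
  set B : Tor M → ℝ := fun y' => (1 / 2) * (ga * (1 + CHQ)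
      + gb * (1 + CT) * Real.exp (m * (torusSupNorm M (rep M y' - rep M y₀) - ℓ₀))) with hBdef
  have hJB : ∀ j, ‖J j‖ ≤ B (blockOf n M j.1) := by
    intro j
    rw [hJ, Pi.smul_apply, norm_smul]
    have h12 : ‖(1 / 2 : ℂ)‖ = 1 / 2 := by rw [norm_div, norm_one, Complex.norm_ofNat]
    rw [h12, hBdef]
    refine mul_le_mul_of_nonneg_left ?_ (by norm_num)
    have h := norm_curlAdjCurl_mulVec_le_localised n M x hx y₀ ℓ₀ Sf hSf hga hgb hg hm0 hmκ j
      (torusSupNorm M (rep M (blockOf n M j.1) - rep M y₀)) le_rfl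
    refine h.trans (le_of_eq ?_)
    rw [show m * (torusSupNorm M (rep M (blockOf n M j.1) - rep M y₀) + 1 - ℓ₀)
        = m * (torusSupNorm M (rep M (blockOf n M j.1) - rep M y₀) - ℓ₀) + m by ring, Real.exp_add, hCT]
    ring
  -- the two gradient entries
  have hent : ∀ ν' μ' : Fin (d + 1), ‖(fdiff (fine n M) (n : ℂ) ν' *ᵥ ((DeltaA n M 1)⁻¹ *ᵥ J)) (bpt n M y₀ r, μ')‖
      ≤ (1 / 2) * ((C * (1 + CHQ) * latticeConst (d + 1) δ₀) * ga + (C * (1 + CT) * latticeConst (d + 1) (δ₀ - m)) * Real.exp (-(m * ℓ₀)) * gb) := by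
    intro ν' μ'
    have h := norm_fdiff_inv_mulVec_le_blockwise n M hrow J B hJB y₀ r ν' μ'
    refine h.trans ?_
    -- split the block sum into the `g_a` and the `g_b` parts
    have hsplit : ∀ y' : Tor M, Real.exp (-(δ₀ * torusSupNorm M (rep M y₀ - rep M y'))) * B y'
        = (1 / 2) * (ga * (1 + CHQ)) * Real.exp (-(δ₀ * torusSupNorm M (rep M y₀ - rep M y')))
          + (1 / 2) * (gb * (1 + CT) * Real.exp (-(m * ℓ₀)))
              * (Real.exp (-(δ₀ * torusSupNorm M (rep M y₀ - rep M y'))) * Real.exp (m * torusSupNorm M (rep M y₀ - rep M y'))) := by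
      intro y'
      simp only [hBdef]
      rw [torusSupNorm_rep_sub_comm M y' y₀,
        show m * (torusSupNorm M (rep M y₀ - rep M y') - ℓ₀) = m * torusSupNorm M (rep M y₀ - rep M y') + (-(m * ℓ₀)) by ring, Real.exp_add]
      ring
    have hterm : ∀ y' : Tor M, Real.exp (-(δ₀ * torusSupNorm M (rep M y₀ - rep M y'))) * Real.exp (m * torusSupNorm M (rep M y₀ - rep M y'))
        ≤ Real.exp (-((δ₀ - m) * torusSupNorm M (rep M y₀ - rep M y'))) := by
      intro y'
      rw [← Real.exp_add]
      exact Real.exp_le_exp.mpr (by nlinarith [torusSupNorm_nonneg (one_le_M M) (rep M y₀ - rep M y')])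
    have hsum1 := sum_exp_torusSupNorm_sub_rep_le M hδ₀ (rep M y₀)
    have hsum2 := sum_exp_torusSupNorm_sub_rep_le M (show 0 < δ₀ - m by linarith) (rep M y₀)
    simp only [hsplit]
    rw [Finset.sum_add_distrib, ← Finset.mul_sum, ← Finset.mul_sum]
    have hA : C * ((1 / 2) * (ga * (1 + CHQ)) * ∑ y' : Tor M, Real.exp (-(δ₀ * torusSupNorm M (rep M y₀ - rep M y'))))
        ≤ (1 / 2) * ((C * (1 + CHQ) * latticeConst (d + 1) δ₀) * ga) := by
      have := mul_le_mul_of_nonneg_left hsum1 (show 0 ≤ C * ((1 / 2) * (ga * (1 + CHQ))) by positivity)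
      calc _ = C * ((1 / 2) * (ga * (1 + CHQ))) * ∑ y' : Tor M, Real.exp (-(δ₀ * torusSupNorm M (rep M y₀ - rep M y'))) := by ring
        _ ≤ C * ((1 / 2) * (ga * (1 + CHQ))) * latticeConst (d + 1) δ₀ := this
        _ = _ := by ring
    have hBsum : ∑ y' : Tor M, Real.exp (-(δ₀ * torusSupNorm M (rep M y₀ - rep M y'))) * Real.exp (m * torusSupNorm M (rep M y₀ - rep M y'))
        ≤ latticeConst (d + 1) (δ₀ - m) := (Finset.sum_le_sum fun y' _ => hterm y').trans hsum2
    have hBb : C * ((1 / 2) * (gb * (1 + CT) * Real.exp (-(m * ℓ₀)))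
          * ∑ y' : Tor M, Real.exp (-(δ₀ * torusSupNorm M (rep M y₀ - rep M y'))) * Real.exp (m * torusSupNorm M (rep M y₀ - rep M y')))
        ≤ (1 / 2) * ((C * (1 + CT) * latticeConst (d + 1) (δ₀ - m)) * Real.exp (-(m * ℓ₀)) * gb) := by
      have := mul_le_mul_of_nonneg_left hBsum (show 0 ≤ C * ((1 / 2) * (gb * (1 + CT) * Real.exp (-(m * ℓ₀)))) by positivity)
      calc _ = C * ((1 / 2) * (gb * (1 + CT) * Real.exp (-(m * ℓ₀)))) * ∑ y' : Tor M,
            Real.exp (-(δ₀ * torusSupNorm M (rep M y₀ - rep M y'))) * Real.exp (m * torusSupNorm M (rep M y₀ - rep M y')) := by ring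
        _ ≤ C * ((1 / 2) * (gb * (1 + CT) * Real.exp (-(m * ℓ₀)))) * latticeConst (d + 1) (δ₀ - m) := this
        _ = _ := by ring
    rw [mul_add]
    linarith
  -- the plaquette value through the Feynman gauge (G1 §4)
  have h1 := hent μ ν
  have h2 := hent ν μ
  rw [Fs_eq_fdiff_DeltaA_inv n M x hx μ ν (bpt n M y₀ r), ← hJ]
  have hga' : 0 ≤ (C * (1 + CHQ) * latticeConst (d + 1) δ₀) * ga := by positivity
  have hgb' : 0 ≤ Real.exp (-(m * ℓ₀)) * gb := by positivity
  calc _ ≤ ‖(fdiff (fine n M) (n : ℂ) μ *ᵥ ((DeltaA n M 1)⁻¹ *ᵥ J)) (bpt n M y₀ r, ν)‖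
          + ‖(fdiff (fine n M) (n : ℂ) ν *ᵥ ((DeltaA n M 1)⁻¹ *ᵥ J)) (bpt n M y₀ r, μ)‖ := norm_sub_le _ _
    _ ≤ (C * (1 + CHQ) * latticeConst (d + 1) δ₀) * ga + (C * (1 + CT) * latticeConst (d + 1) (δ₀ - m)) * Real.exp (-(m * ℓ₀)) * gb := by
        linarith
    _ ≤ (C * (1 + CHQ) * latticeConst (d + 1) δ₀ + 1) * ga + (C * (1 + CT) * latticeConst (d + 1) (δ₀ - m) + 1) * Real.exp (-(m * ℓ₀)) * gb := by
        nlinarith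

end

end Summit.QuantumFields.BalabanUV.T4Continuum.NE7SliceGreenTorusLocalised
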